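import Summits.Ventures.CertifiedManyBodySolver.Theorems.M3x2EdgeSplitSymReplayOutRouteM
import Summits.Ventures.CertifiedManyBodySolver.Theorems.M3x2EdgeSplitSymReplayDecode
import HarnessLib

/-!
# SymReplay gramR — OUTROUTE (T20d): residual splitter, the `ℤ⁶` per-spin dipole valuation of record, the engine END TO END

(o) RESIDUAL SPLITTER for classes a finer additive valuation cannot break: `shareRFastM₂` = one module's share filtered by a
secondary key `κ₂`, with `shareRFastM₂_perm` against `shareR K (momKey₂ S hm κ₂ J L) (J·L) (L·i + f)` (T20b §(h) closes it).
(q) `Mom := ℤ⁶ = (Q↑, Q↓, D↑₀, D↑₁, D↓₀, D↓₁)`, `momL` (a creator / annihilator contributes `±(1, x)` in its spin block — a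
contracted `c c†` pair at one mode contributes `0`, so the valuation is normal-ordering-invariant; translation-invariant on
per-spin-neutral words, i.e. on every R-product of a sector-pure certificate; the point group acts linearly), the valuation of
record `momSpec6 : MomSpec Mom` for v0′/E-class tables, and `d4ImagesM` (the producer closes its table under these);
(q′) the PACKED valuation `momSpecZ B : MomSpec ℤ` (one integer per moment ⇒ one-word hash and lookup key) with
`mom_momSpecZ : mom (momSpecZ B) w = packM B (mom momSpec6 w)`; (q″) the DATA PATH `decodeMomTab`/`momTable6`/`momTableZ` for tables
shipped as integer text (`…Decode` tokens: `n (qU qD D↑₀ D↑₁ D↓₀ D↓₁ idx)ⁿ`).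
(r) DEMO: a producer-side table for the toy (every occurring raw-residual moment, R-products AND base residual, closed under the
point group, indexed by an invariant class code), `J = 3` modules, box canon, closed through `energyDensity_ge_of_outrouteM`.
`Std.HashMap` does not reduce in the kernel, so the EXECUTED side of the examples runs through the compiler (`native_decide`)
exactly as certificate modules do; no declaration of this module carries `Lean.ofReduceBool`.  A table that is NOT orbit-closed
or misses the base residual's moments makes a module FAIL — never certify wrongly (with bare product moments, toy modules 0 and 2
do fail).  HONEST FRAMING: a key instance and a demo; no certificate of record is replayed; no bound of record moves; no summit or
crux statement is proved; nothing here predicts superconductivity.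
-/

namespace Summit.Ventures.CertifiedManyBodySolver.Theorems.SymReplay

open Literature.MathematicalPhysics.QuantumLattice.ThermodynamicLimit

/-! ##### (o) Residual splitter for oversize classes: a SECONDARY filter on one module's enumerated share (the lookup
skeleton re-runs `L` times for that module only; the composite key `L·(momKey % J) + κ₂ % L` is still a plain `Word → ℕ`, so
T20a applies).  A finer additive valuation (a richer `MomSpec`) is the first lever; this splits what it cannot. -/

section Split

variable {M : Type} [DecidableEq M] [Hashable M]

/-- The composite key of the two-level split. -/
def momKey₂ (S : MomSpec M) (hm : MomTable M) (κ₂ : Word → ℕ) (J L : ℕ) (w : Word) : ℕ :=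
  L * (momKey S hm w % J) + κ₂ w % L

/-- Sub-module `(i, f)`: module `i`'s moment-bucketed share, filtered by the secondary key. -/
def shareRFastM₂ (S : MomSpec M) (K : SymCertR) (gbs : List (List QPoly)) (hm : MomTable M) (κ₂ : Word → ℕ)
    (J L i f : ℕ) : QPoly :=
  (shareRFastM S K gbs hm J i).filter (wordPred fun w => κ₂ w % L == f)

/-- The composite key's slot among `J·L` is `L·i + f` exactly for (moment slot `i`, secondary slot `f`). -/
theorem momKey₂_slot (S : MomSpec M) (hm : MomTable M) (κ₂ : Word → ℕ) {J L : ℕ} (hJ : 0 < J) (hL : 0 < L)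
    (w : Word) (i f : ℕ) (hf : f < L) :
    slotOf (momKey₂ S hm κ₂ J L) (J * L) w = L * i + f ↔ momKey S hm w % J = i ∧ κ₂ w % L = f := by
  have h1 : momKey S hm w % J < J := Nat.mod_lt _ hJ
  have h2 : κ₂ w % L < L := Nat.mod_lt _ hL
  have hlt : L * (momKey S hm w % J) + κ₂ w % L < J * L := by
    calc L * (momKey S hm w % J) + κ₂ w % L < L * (momKey S hm w % J) + L := by omega
      _ = L * (momKey S hm w % J + 1) := by ring
      _ ≤ L * J := Nat.mul_le_mul_left _ h1
      _ = J * L := Nat.mul_comm _ _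
  rw [slotOf, momKey₂, Nat.mod_eq_of_lt hlt]
  constructor
  · intro h
    have hb : (L * (momKey S hm w % J) + κ₂ w % L) % L = (L * i + f) % L := by rw [h]
    rw [Nat.mul_add_mod, Nat.mul_add_mod, Nat.mod_eq_of_lt h2, Nat.mod_eq_of_lt hf] at hb
    have ha : (L * (momKey S hm w % J) + κ₂ w % L) / L = (L * i + f) / L := by rw [h]
    rw [Nat.mul_add_div hL, Nat.mul_add_div hL, Nat.div_eq_of_lt h2, Nat.div_eq_of_lt hf] at ha
    exact ⟨by simpa using ha, hb⟩
  · rintro ⟨ha, hb⟩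
    rw [ha, hb]

/-- **Two-level split is a permutation of the composite-key share** (so `energyDensity_ge_of_outrouteSB` closes it with
`κ := momKey₂ S hm κ₂ J L`, `J·L` modules, `S (L·i+f) := shareRFastM₂ … i f`). -/
theorem shareRFastM₂_perm (S : MomSpec M) (K : SymCertR) (hm : MomTable M) (κ₂ : Word → ℕ) {J L : ℕ} (hJ : 0 < J)
    (hL : 0 < L) (i f : ℕ) (hf : f < L) (hcov : coverM S K (K.gramR.map genBasis) hm = true) :
    (shareRFastM₂ S K (K.gramR.map genBasis) hm κ₂ J L i f).Perm
      (shareR K (momKey₂ S hm κ₂ J L) (J * L) (L * i + f)) := by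
  rw [shareRFastM₂]
  refine ((shareRFastM_perm S K hm J i hcov).filter _).trans (List.Perm.of_eq ?_)
  rw [shareR_eq, shareR_eq, List.filter_filter]
  refine List.filter_congr fun t _ => ?_
  rw [Bool.eq_iff_iff, Bool.and_eq_true, wordPred_inSlotW_iff, wordPred_inSlotW_iff,
    momKey₂_slot S hm κ₂ hJ hL t.2 i f hf, slotOf]
  simp [wordPred, and_comm]

end Split

/-! ##### (q) The `ℤ⁶` per-spin dipole valuation -/

/-- Per-spin charges and dipole moments `(Q↑, Q↓, D↑₀, D↑₁, D↓₀, D↓₁)`. -/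
abbrev Mom := ℤ × ℤ × ℤ × ℤ × ℤ × ℤ

/-- Componentwise sum. -/
def Mom.add (a b : Mom) : Mom :=
  (a.1 + b.1, a.2.1 + b.2.1, a.2.2.1 + b.2.2.1, a.2.2.2.1 + b.2.2.2.1, a.2.2.2.2.1 + b.2.2.2.2.1,
    a.2.2.2.2.2 + b.2.2.2.2.2)

/-- Componentwise difference. -/
def Mom.sub (a b : Mom) : Mom :=
  (a.1 - b.1, a.2.1 - b.2.1, a.2.2.1 - b.2.2.1, a.2.2.2.1 - b.2.2.2.1, a.2.2.2.2.1 - b.2.2.2.2.1,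
    a.2.2.2.2.2 - b.2.2.2.2.2)

/-- Associativity of `Mom.add`. -/
theorem Mom.add_assoc (a b c : Mom) : Mom.add (Mom.add a b) c = Mom.add a (Mom.add b c) := by
  obtain ⟨a1, a2, a3, a4, a5, a6⟩ := a
  obtain ⟨b1, b2, b3, b4, b5, b6⟩ := b
  obtain ⟨c1, c2, c3, c4, c5, c6⟩ := c
  simp only [Mom.add, Prod.mk.injEq]
  omega

/-- Left unit. -/
theorem Mom.zero_add (a : Mom) : Mom.add (0, 0, 0, 0, 0, 0) a = a := by
  obtain ⟨a1, a2, a3, a4, a5, a6⟩ := a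
  simp only [Mom.add, Prod.mk.injEq]
  omega

/-- `c = a − b ↔ b + c = a`. -/
theorem Mom.eq_sub_iff_add_eq (a b c : Mom) : c = Mom.sub a b ↔ Mom.add b c = a := by
  obtain ⟨a1, a2, a3, a4, a5, a6⟩ := a
  obtain ⟨b1, b2, b3, b4, b5, b6⟩ := b
  obtain ⟨c1, c2, c3, c4, c5, c6⟩ := c
  simp only [Mom.add, Mom.sub, Prod.mk.injEq]
  omega

/-- Moment of one letter: `±1` (creator / annihilator) times `(1, x)` in the letter's spin block. -/
def momL (ℓ : Letter) : Mom :=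
  let sg : ℤ := if ℓ.dag then 1 else -1
  if ℓ.s = 0 then (sg, 0, sg * ℓ.x 0, sg * ℓ.x 1, 0, 0) else (0, sg, 0, 0, sg * ℓ.x 0, sg * ℓ.x 1)

/-- **The valuation of record** for v0′/E-class moment tables. -/
def momSpec6 : MomSpec Mom where
  φ := momL
  add := Mom.add
  sub := Mom.sub
  zero := (0, 0, 0, 0, 0, 0)
  add_assoc := Mom.add_assoc
  zero_add := Mom.zero_add
  eq_sub_iff_add_eq := Mom.eq_sub_iff_add_eq

/-- The eight point-group images of a moment (`D₄` acting on both dipoles at once). -/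
def d4ImagesM (m : Mom) : List Mom :=
  let qU := m.1; let qD := m.2.1; let a := m.2.2.1; let b := m.2.2.2.1; let c := m.2.2.2.2.1; let d := m.2.2.2.2.2
  [(qU, qD, a, b, c, d), (qU, qD, -a, b, -c, d), (qU, qD, a, -b, c, -d), (qU, qD, -a, -b, -c, -d),
    (qU, qD, b, a, d, c), (qU, qD, -b, a, -d, c), (qU, qD, b, -a, d, -c), (qU, qD, -b, -a, -d, -c)]

/-! ##### (q′) The PACKED valuation: the six moments in ONE integer (cheap hash and lookup key; linear ⇒ additive) -/

/-- `(qU, qD, a, b, c, d) ↦ qU + qD·B + a·B² + b·B³ + c·B⁴ + d·B⁵` (injective while every component stays below `B/2` in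
absolute value — collisions would only merge classes; the producer picks `B` and packs its table the same way). -/
def packM (B : ℤ) (m : Mom) : ℤ :=
  m.1 + m.2.1 * B + m.2.2.1 * (B * B) + m.2.2.2.1 * (B * B * B) + m.2.2.2.2.1 * (B * B * B * B) +
    m.2.2.2.2.2 * (B * B * B * B * B)

/-- Packed letter moment (= `packM B (momL ℓ)`, written out). -/
def momLZ (B : ℤ) (ℓ : Letter) : ℤ :=
  let sg : ℤ := if ℓ.dag then 1 else -1
  if ℓ.s = 0 then sg * (1 + ℓ.x 0 * (B * B) + ℓ.x 1 * (B * B * B))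
  else sg * (B + ℓ.x 0 * (B * B * B * B) + ℓ.x 1 * (B * B * B * B * B))

/-- `momLZ` is the packed `momL`. -/
theorem momLZ_eq (B : ℤ) (ℓ : Letter) : momLZ B ℓ = packM B (momL ℓ) := by
  unfold momLZ momL packM
  by_cases h : ℓ.s = 0 <;> by_cases hd : ℓ.dag = true <;> simp [h, hd] <;> ring

/-- **The packed valuation** (key type `ℤ`: one-word hash, no tuple allocation per lookup). -/
def momSpecZ (B : ℤ) : MomSpec ℤ where
  φ := momLZ B
  add := (· + ·)
  sub := (· - ·)
  zero := 0
  add_assoc := add_assoc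
  zero_add := zero_add
  eq_sub_iff_add_eq := fun a b c => by constructor <;> intro h <;> omega

/-- `packM` is additive. -/
theorem packM_add (B : ℤ) (a b : Mom) : packM B (Mom.add a b) = packM B a + packM B b := by
  unfold packM Mom.add; ring

/-- **Packed moments are the packed `ℤ⁶` moments** (so a producer packs its `ℤ⁶` table with `packM B`). -/
theorem mom_momSpecZ (B : ℤ) (w : Word) : mom (momSpecZ B) w = packM B (mom momSpec6 w) := by
  induction w with
  | nil => simp [mom, momSpecZ, momSpec6, packM]
  | cons ℓ w ih =>
    rw [mom, mom, ih]
    change momLZ B ℓ + _ = packM B (Mom.add (momL ℓ) (mom momSpec6 w))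
    rw [packM_add, momLZ_eq]

/-! ##### (q″) DATA PATH: a moment table shipped as integer text `n (qU qD D↑₀ D↑₁ D↓₀ D↓₁ idx)ⁿ` (`…Decode` tokens) -/

/-- Read `n` moment-table records `qU qD D↑₀ D↑₁ D↓₀ D↓₁ idx` (junk-tolerant like every `rd*`). -/
def rdMomTab : ℕ → Toks → List (Mom × ℕ) × Toks
  | 0, ts => ([], ts)
  | n + 1, q1 :: q2 :: a :: b :: c :: d :: i :: ts =>
    let r := rdMomTab n ts
    (((q1, q2, a, b, c, d), i.toNat) :: r.1, r.2)
  | _ + 1, ts => ([], ts)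

/-- **Decode a moment table** (entries in shipping order). -/
def decodeMomTab (ts : Toks) : List (Mom × ℕ) := let c := rdNat ts; (rdMomTab c.1 c.2).1

/-- Leftover tokens after the table (`0` on a well-formed stream — a cheap sanity fact for certificate modules). -/
def decodeMomTabRest (ts : Toks) : ℕ := let c := rdNat ts; (rdMomTab c.1 c.2).2.length

/-- The `ℤ⁶` table of decoded entries (`momSpec6`). -/
def momTable6 (es : List (Mom × ℕ)) : MomTable Mom := momTable es

/-- The packed table of decoded entries (`momSpecZ B`; same classes, one-integer keys). -/
def momTableZ (B : ℤ) (es : List (Mom × ℕ)) : MomTable ℤ := momTable (es.map fun e => (packM B e.1, e.2))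

/-! ##### (r) Demo on `toyRCert` -/

/-- A toy class index: a point-group-invariant function of a NEUTRAL moment (`|D↑|² + |D↓|² + D↑·D↓ + 7`). -/
def toyClass (m : Mom) : ℕ :=
  (m.2.2.1 * m.2.2.1 + m.2.2.2.1 * m.2.2.2.1 + m.2.2.2.2.1 * m.2.2.2.2.1 + m.2.2.2.2.2 * m.2.2.2.2.2 +
    (m.2.2.1 * m.2.2.2.2.1 + m.2.2.2.1 * m.2.2.2.2.2) + 7).toNat

/-- The toy table: every occurring moment (R-products AND base residual), orbit-closed, ↦ its class index. -/
def toyTab : MomTable Mom :=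
  let occ := productMoms momSpec6 toyRCert (toyRCert.gramR.map genBasis) ++
    (baseShardL toyRCert.toSymCert).map fun t => mom momSpec6 t.2
  momTable ((occ.flatMap d4ImagesM).map fun m => (m, toyClass m))

/- `Std.HashMap` does not reduce in the kernel, so the executed side of the toys runs through the compiler
(`native_decide`), exactly as certificate modules do; nothing below is a declaration. -/
example : coverM momSpec6 toyRCert (toyRCert.gramR.map genBasis) toyTab = true := by native_decide

/-- The three moment-bucketed shares have the sizes of the three `shareR` shares under `momKey momSpec6 toyTab`. -/
example : (List.range 3).map (fun i => (shareRFastM momSpec6 toyRCert (toyRCert.gramR.map genBasis) toyTab 3 i).length) =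
    (sharesR toyRCert (momKey momSpec6 toyTab) 3).map List.length := by native_decide

example : ((symValueR toyRCert : ℚ) : ℝ) ≤ energyDensityTT' 1 0 8 (7 / 8) :=
  energyDensity_ge_of_outrouteM momSpec6 toyRCert (by decide +kernel)
    (gramR_all_of_factsB toyRCert (minCornerP frame3) (maxCornerP frame3) (by decide +kernel) 2 (by decide +kernel)
      ⟨by decide +kernel, by decide +kernel, trivial⟩)
    toyTab 3 (by norm_num) (minCornerP frame3) (maxCornerP frame3) (by decide +kernel) (by native_decide)
    ⟨by native_decide, by native_decide, by native_decide, trivial⟩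


/-- The toy table, packed (base 64). -/
def toyTabZ : MomTable ℤ :=
  let occ := productMoms momSpec6 toyRCert (toyRCert.gramR.map genBasis) ++
    (baseShardL toyRCert.toSymCert).map fun t => mom momSpec6 t.2
  momTable ((occ.flatMap d4ImagesM).map fun m => (packM 64 m, toyClass m))

/-- Packed and unpacked engines enumerate shares of the same sizes on the toy. -/
example : (List.range 3).map (fun i => (shareRFastM (momSpecZ 64) toyRCert (toyRCert.gramR.map genBasis) toyTabZ 3 i).length)
    = (List.range 3).map (fun i => (shareRFastM momSpec6 toyRCert (toyRCert.gramR.map genBasis) toyTab 3 i).length) := by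
  native_decide

example : ((symValueR toyRCert : ℚ) : ℝ) ≤ energyDensityTT' 1 0 8 (7 / 8) :=
  energyDensity_ge_of_outrouteM (momSpecZ 64) toyRCert (by decide +kernel)
    (gramR_all_of_factsB toyRCert (minCornerP frame3) (maxCornerP frame3) (by decide +kernel) 2 (by decide +kernel)
      ⟨by decide +kernel, by decide +kernel, trivial⟩)
    toyTabZ 3 (by norm_num) (minCornerP frame3) (maxCornerP frame3) (by decide +kernel) (by native_decide)
    ⟨by native_decide, by native_decide, by native_decide, trivial⟩


/-- Data-path round trip: two records decode to the two entries (text → table). -/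
example : (decodeMomTab (toks "2  0 0 1 -2 0 3 5   0 0 -1 0 2 0 7") ==
      [((0, 0, 1, -2, 0, 3), 5), ((0, 0, -1, 0, 2, 0), 7)]) = true ∧
    decodeMomTabRest (toks "2  0 0 1 -2 0 3 5   0 0 -1 0 2 0 7") = 0 := by native_decide


/-! ##### (s) Coverage by BLOCK RANGES (E-class glue: the ONE `coverM` fact split across fact modules when it outgrows one) -/

section CoverRanges

variable {M : Type} [DecidableEq M] [Hashable M]

/-- The per-block body of `coverM`. -/
def coverBlock (S : MomSpec M) (hm : MomTable M) (Bg : GramBlockR × List QPoly) : Bool :=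
  let ks := (bucketOf S (wflat (Bg.2.zip Bg.1.rows))).keys
  (Bg.1.reps.zip Bg.1.rows).all fun a =>
    (padj a.1).all fun t => ks.all fun mw => hm.contains (S.add (mom S t.2) mw)

/-- `coverM` is `coverBlock` on every block. -/
theorem coverM_eq_all (S : MomSpec M) (K : SymCertR) (gbs : List (List QPoly)) (hm : MomTable M) :
    coverM S K gbs hm = (K.gramR.zip gbs).all (coverBlock S hm) := rfl

/-- **Coverage of the block slice `[b0, b0 + n)`** (one fact module per slice). -/
def coverMR (S : MomSpec M) (K : SymCertR) (gbs : List (List QPoly)) (hm : MomTable M) (b0 n : ℕ) : Bool :=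
  (((K.gramR.zip gbs).drop b0).take n).all (coverBlock S hm)

/-- Two adjacent slices make one. -/
theorem coverMR_add (S : MomSpec M) (K : SymCertR) (gbs : List (List QPoly)) (hm : MomTable M) (b0 m n : ℕ)
    (h1 : coverMR S K gbs hm b0 m = true) (h2 : coverMR S K gbs hm (b0 + m) n = true) :
    coverMR S K gbs hm b0 (m + n) = true := by
  rw [coverMR] at h1 h2 ⊢
  rw [List.take_add, List.all_append, h1, Bool.true_and, List.drop_drop]
  exact h2

/-- **`coverM` from slices**: a first slice from `0` and a second slice reaching the end give the global fact. -/
theorem coverM_of_ranges (S : MomSpec M) (K : SymCertR) (gbs : List (List QPoly)) (hm : MomTable M) (k n : ℕ)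
    (hn : (K.gramR.zip gbs).length ≤ k + n) (h1 : coverMR S K gbs hm 0 k = true)
    (h2 : coverMR S K gbs hm k n = true) : coverM S K gbs hm = true := by
  have h := coverMR_add S K gbs hm 0 k n h1 (by rwa [Nat.zero_add])
  rw [coverMR, List.drop_zero, List.take_of_length_le (by omega)] at h
  exact h

/-- Toy: the two-block toy certificate covered slice by slice. -/
example : coverM momSpec6 toyRCert (toyRCert.gramR.map genBasis) toyTab = true :=
  coverM_of_ranges momSpec6 toyRCert _ toyTab 1 1 (by native_decide) (by native_decide) (by native_decide)

end CoverRanges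

end Summit.Ventures.CertifiedManyBodySolver.Theorems.SymReplay
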